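import Mathlib.RingTheory.MvPolynomial.Basic
import Mathlib.Algebra.MvPolynomial.Degrees
import Mathlib.Algebra.Ring.SumsOfSquares
import Literature.Computability.Complexity.BonamiLevelK
import HarnessLib

/-!
# Sum-of-squares proofs of the `(2,4)`-hypercontractive inequality on the cube
# (Barak–Brandão–Harrow–Kelner–Steurer–Zhou 2012; Kauers–O'Donnell–Tan–Zhou 2014)

Sources (read first-hand, arXiv PDFs, 2026-08-28):
* B. Barak, F. Brandão, A. Harrow, J. Kelner, D. Steurer, Y. Zhou, *Hypercontractivity,
  sum-of-squares proofs, and their applications*, STOC 2012; arXiv:1205.4484v2 (30 Oct 2012)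
  [BarakBrandaoHarrowKelnerSteurerZhou2012]: §3.1 p. 8 ("we say that `P ⪯ Q` holds … if `Q − P`, as a
  polynomial [in the coefficients], is a sum of squares"), §3.2 p. 9 eq. (3.2)–(3.3), Theorem 2.2
  (p. 3), Lemma 5.1 (p. 13) and its proof (p. 13–14, eq. (5.1)).
* M. Kauers, R. O'Donnell, L.-Y. Tan, Y. Zhou, *Hypercontractive inequalities via SOS, and the
  Frankl–Rödl graph*, SODA 2014; arXiv:1212.5324v3 (1 Mar 2016) [KauersODonnellTanZhou2012]: §2 p. 6
  ("`⊢ₖ p ≥ 0` … simply means that `p` is SOS and `deg(p) ≤ k`"), Theorem 1.4 (p. 3) = Theorem 3.4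
  (p. 8, eq. (3)), the case `s = 2` (`q = 4`, Rademacher variables).

THE STATEMENTS. Work over the Boolean cube `{0,1}ⁿ` with the tree's Walsh characters
`χ_S(x) = ∏_{i∈S} (−1)^{xᵢ}` (`walsh`, file `Probability/RandomGraphs/LowDegree.lean`; this is the
`{±1}ⁿ` of the sources). A "Fourier polynomial" `f = Σ_S f̂(S) χ_S` is regarded, as in both sources,
as a function of INDETERMINATE coefficients `f̂(S)`: here the coefficients are elements `a S` of a
polynomial ring `MvPolynomial σ ℝ` of total degree `≤ 1` (indeterminates, linear forms, or `0` — "this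
polynomial relation is over the linear space of pairs of Fourier polynomials `(f, g)`", BBHKSZ p. 13),
so that `f(x) = Σ_S χ_S(x)·a S` (`fourierPoly a x`), `E f² = Σ_S (a S)²` (`sqNorm a`, Parseval:
`expect_fourierPoly_sq`) and `E f⁴ = 2⁻ⁿ Σ_x f(x)⁴` are polynomials of degree `≤ 2`, `≤ 2`, `≤ 4` in the
coefficient variables. `IsSosDeg k p` ("`p` is a sum of squares of polynomials of total degree `≤ k`")
is the certificate form of BBHKSZ's `0 ⪯ p` / KOTZ's `⊢_{2k} p ≥ 0` (it implies `deg p ≤ 2k`,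
`IsSosDeg.totalDegree_le`, and Mathlib's `IsSumSq p`, `IsSosDeg.isSumSq`; BBHKSZ p. 8 remark that the
squares in a certificate of a degree-`4` relation have degree `≤ 2`, which we record IN the predicate
rather than derive), and it is exactly what a degree-`2k` pseudo-expectation consumes
(`IsSosDeg.pseudoexpectation_nonneg`).

* `two_function_sos_hypercontractivity_noise` — **KOTZ Theorem 3.4 for `s = 2`** (p. 8, eq. (3)), in
  cleared-denominator form: for coefficient families `a, b` of degree `≤ 1`,
  `2ⁿ·(Σ_S 3^{|S|}(a S)²)(Σ_U 3^{|U|}(b U)²) − Σ_x f(x)² g(x)²` is a sum of squares of polynomials of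
  degree `≤ 2`; equivalently (`…_noise_rho`, as printed) `⊢₄ E[(T_ρ f)²(T_ρ g)²] ≤ E[f²]·E[g²]` for
  `0 ≤ ρ ≤ 1/√3` (`T_ρ` multiplies `f̂(S)` by `ρ^{|S|}`).  Proof = the induction on `n` of BBHKSZ
  p. 13–14 / KOTZ p. 8–9: split off one coordinate, `f = f₀ + xₙ f₁`; the only inequality used is
  `4 f₀f₁g₀g₁ ⪯ 2 f₀²g₁² + 2 f₁²g₀²`, i.e. the square `2(f₀g₁ − f₁g₀)²` (BBHKSZ eq. (5.1)); in the
  weighted (`T_{1/√3}`) form the four resulting terms are instances of the induction hypothesis with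
  no degree bookkeeping (this is how KOTZ organise it), and the degree-`d` statements follow by
  comparing weights.
* `two_function_sos_hypercontractivity` — **BBHKSZ, proof of Lemma 5.1, the two-function statement**
  (p. 13): if `f̂(S) = 0` for `|S| > d` and `ĝ(U) = 0` for `|U| > e` then
  `⊢₄ E[f²g²] ≤ 9^{(d+e)/2}·E[f²]·E[g²]` (`9^{(d+e)/2} = 3^{d+e}`).
* `sos_hypercontractivity` — **BBHKSZ Lemma 5.1** (p. 13) / eq. (3.3) (p. 9): for `f` of degree `≤ d`,
  `9^d (E f²)² − E f⁴ = Σᵢ Qᵢ²` with `Qᵢ` polynomials of degree `≤ 2` in the coefficients.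
* `sos_hypercontractivity_projector` — **BBHKSZ Theorem 2.2** (p. 3) / **KOTZ Theorem 1.1 in SOS**
  (p. 3: "as corollaries we have SOS proofs of `‖T_ρ f‖_q^q ≤ ‖f‖₂^q` and
  `‖P^{≤k} f‖_q^q ≤ (q−1)^{qk/2}‖f‖₂^q`", here `q = 4`): with ALL `2ⁿ` coefficients `f̂(S) = X_S` as
  indeterminates and `P_d f = Σ_{|S|≤d} f̂(S)χ_S`, `⊢₄ ‖P_d f‖₄⁴ ≤ 9^d ‖f‖₂⁴`; `…_noise_self`:
  `⊢₄ ‖T_ρ f‖₄⁴ ≤ ‖f‖₂⁴` for `0 ≤ ρ ≤ 1/√3`.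
* `pseudoexpectation_fourthMoment_le` — the consumer form of Theorem 2.2 ("the SoS relaxation
  certifies `‖P_d‖_{2→4} ≤ 9^{d/4}`", p. 9): every linear functional `Ẽ` on the coefficient
  polynomials that is nonnegative on squares of polynomials of degree `≤ 2` (a degree-`4`
  pseudo-expectation in the sense of `Literature.Computability.MetaComplexity.IsPseudoexpectation`)
  satisfies `Ẽ[E_x (P_d f)(x)⁴] ≤ 9^d · Ẽ[(Σ_S f̂(S)²)²]`.

* §5: `IsSosDeg.mul` (certificates multiply, degrees add — "each inequality is multiplied against an SOS
  polynomial", KOTZ p. 9), the evaluation bridge to the tree's real-valued Fourier analysis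
  (`eval_fourierPoly_X`, `eval_fourierPoly_X_cubeFourierCoeff`: at `c = ĝ` the universal Fourier polynomial
  evaluates to `g(x)` by `LowDegree.sum_cubeFourierCoeff_mul_walsh`), and BBHKSZ eq. (3.2) — the numerical
  inequality `2⁻ⁿ Σ_x (Σ_S c_S χ_S(x))⁴ ≤ 9^d (Σ_S c_S²)²` for coefficients supported on `|S| ≤ d` — read off
  the certificate by `IsSosDeg.eval_nonneg` (`hypercontractivity_of_certificate`; the tree's
  `LowDegree.bonami_even_moment`, `r = 2`, is the same inequality proved directly and in all even moments).
Everything here is proved; no named facts.  Printed open questions recorded for the harvest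
(KOTZ §6 "Conclusions", p. 17): an `O(1)`-degree SOS proof of the Frankl–Rödl theorem at
`γ ≈ √(log n / n)`, and of the toy statement "`dist(A,B) ≥ √(n log n) ⇒ |A||B|/4ⁿ = o(1)`", are open.
-/

noncomputable section

open Finset MvPolynomial
open Literature.Probability.RandomGraphs.LowDegree (sgn walsh sgn_true sgn_false walsh_empty)
open Literature.Computability.Complexity.LowDegree (walsh_map_succEmb_cons walsh_insert_zero_cons
  card_insert_zero_map_succEmb)

namespace Literature.Computability.Complexity.SosHypercontractivity

variable {σ : Type*}

/-! ### §1 Sum-of-squares certificates with a degree bound on the squares -/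

/-- **`p` is a sum of squares of polynomials of total degree `≤ k`** — the certificate behind
BBHKSZ's "`0 ⪯ p`" for a relation of degree `2k` and KOTZ's "`⊢_{2k} p ≥ 0`".
[cite: BarakBrandaoHarrowKelnerSteurerZhou2012, §3.1 (p. 8)] [cite: KauersODonnellTanZhou2012, §2 (p. 6)] -/
def IsSosDeg (k : ℕ) (p : MvPolynomial σ ℝ) : Prop :=
  ∃ l : List (MvPolynomial σ ℝ), (∀ q ∈ l, q.totalDegree ≤ k) ∧ p = (l.map fun q => q ^ 2).sum

namespace IsSosDeg

variable {k : ℕ} {p p' : MvPolynomial σ ℝ}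

/-- `0` is certified (empty sum). [cite: KauersODonnellTanZhou2012, §2 "Simple SOS facts and lemmas", Lemma 2.2 (p. 6–7)] -/
theorem zero (k : ℕ) : IsSosDeg k (0 : MvPolynomial σ ℝ) := ⟨[], by simp, by simp⟩

/-- A single square of a polynomial of degree `≤ k` is certified. [cite: KauersODonnellTanZhou2012, §2 "Simple SOS facts and lemmas", Lemma 2.2 (p. 6–7)] -/
theorem sq {q : MvPolynomial σ ℝ} (hq : q.totalDegree ≤ k) : IsSosDeg k (q ^ 2) :=
  ⟨[q], by simp [hq], by simp⟩

/-- Closure under addition (KOTZ Lemma 2.2). [cite: KauersODonnellTanZhou2012, Lemma 2.2 (p. 7)] -/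
theorem add (h : IsSosDeg k p) (h' : IsSosDeg k p') : IsSosDeg k (p + p') := by
  obtain ⟨l, hl, rfl⟩ := h
  obtain ⟨l', hl', rfl⟩ := h'
  refine ⟨l ++ l', fun q hq => ?_, by simp⟩
  rcases List.mem_append.1 hq with h | h
  · exact hl q h
  · exact hl' q h

/-- Closure under finite sums (iterated Lemma 2.2). [cite: KauersODonnellTanZhou2012, §2 "Simple SOS facts and lemmas", Lemma 2.2 (p. 6–7)] -/
theorem sum {ι : Type*} (s : Finset ι) {f : ι → MvPolynomial σ ℝ}
    (h : ∀ i ∈ s, IsSosDeg k (f i)) : IsSosDeg k (∑ i ∈ s, f i) := by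
  classical
  induction s using Finset.induction_on with
  | empty => simpa using zero k
  | insert i s hi ih =>
    rw [sum_insert hi]
    exact (h i (mem_insert_self i s)).add (ih fun j hj => h j (mem_insert_of_mem hj))

/-- Closure under natural multiples (iterated Lemma 2.2). [cite: KauersODonnellTanZhou2012, §2 "Simple SOS facts and lemmas", Lemma 2.2 (p. 6–7)] -/
theorem nsmul (m : ℕ) (h : IsSosDeg k p) : IsSosDeg k (m • p) := by
  induction m with
  | zero => simpa using zero k
  | succ m ih => rw [succ_nsmul]; exact ih.add h

/-- Closure under multiplication by a nonnegative real (`c·q² = (√c·q)²`). [cite: KauersODonnellTanZhou2012, §2 "Simple SOS facts and lemmas", Lemma 2.2 (p. 6–7)] -/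
theorem smul {c : ℝ} (hc : 0 ≤ c) (h : IsSosDeg k p) : IsSosDeg k (c • p) := by
  obtain ⟨l, hl, rfl⟩ := h
  refine ⟨l.map fun q => C (Real.sqrt c) * q, fun q hq => ?_, ?_⟩
  · obtain ⟨q', hq', rfl⟩ := List.mem_map.1 hq
    exact (totalDegree_mul _ _).trans (by simpa using hl q' hq')
  · rw [List.map_map, List.smul_sum, List.map_map]
    congr 1
    refine List.map_congr_left fun q _ => ?_
    simp only [Function.comp_apply, mul_pow, ← map_pow, Real.sq_sqrt hc, smul_eq_C_mul]

/-- Closure under multiplication by a nonnegative real constant `C c`. [cite: KauersODonnellTanZhou2012, §2 "Simple SOS facts and lemmas", Lemma 2.2 (p. 6–7)] -/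
theorem const_mul {c : ℝ} (hc : 0 ≤ c) (h : IsSosDeg k p) : IsSosDeg k (C c * p) := by
  rw [← smul_eq_C_mul]; exact h.smul hc

/-- Monotonicity in the degree bound (`⊢ₖ` implies `⊢_{k'}` for `k ≤ k'`). [cite: KauersODonnellTanZhou2012, §2 "Simple SOS facts and lemmas", Lemma 2.2 (p. 6–7)] -/
theorem mono {k' : ℕ} (h : IsSosDeg k p) (hk : k ≤ k') : IsSosDeg k' p := by
  obtain ⟨l, hl, rfl⟩ := h
  exact ⟨l, fun q hq => (hl q hq).trans hk, rfl⟩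

/-- A degree-bounded certificate is in particular a sum of squares in Mathlib's sense (`IsSumSq`). [cite: KauersODonnellTanZhou2012, §2 "Simple SOS facts and lemmas", Lemma 2.2 (p. 6–7)] -/
theorem isSumSq (h : IsSosDeg k p) : IsSumSq p := by
  obtain ⟨l, -, rfl⟩ := h
  induction l with
  | nil => simp
  | cons q l ih =>
    rw [List.map_cons, List.sum_cons, pow_two]
    exact IsSumSq.sq_add q ih

/-- The certified polynomial has degree `≤ 2k` (KOTZ's `⊢_{2k}`). [cite: KauersODonnellTanZhou2012, §2 (p. 6)] -/
theorem totalDegree_le (h : IsSosDeg k p) : p.totalDegree ≤ 2 * k := by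
  obtain ⟨l, hl, rfl⟩ := h
  induction l with
  | nil => simp
  | cons q l ih =>
    rw [List.map_cons, List.sum_cons]
    refine (totalDegree_add _ _).trans (max_le ?_ (ih fun q' hq' => hl q' (List.mem_cons_of_mem q hq')))
    refine (totalDegree_pow _ _).trans ?_
    have := hl q (by simp)
    omega

/-- **What a pseudo-expectation consumes**: a linear functional nonnegative on squares of polynomials
of degree `≤ k` is nonnegative on every `IsSosDeg k` polynomial ("by using the positivity
constraints", BBHKSZ p. 9). [cite: BarakBrandaoHarrowKelnerSteurerZhou2012, §3.1–3.2 (p. 8–9)] -/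
theorem pseudoexpectation_nonneg (h : IsSosDeg k p) (E : MvPolynomial σ ℝ →ₗ[ℝ] ℝ)
    (hE : ∀ q : MvPolynomial σ ℝ, q.totalDegree ≤ k → 0 ≤ E (q ^ 2)) : 0 ≤ E p := by
  obtain ⟨l, hl, rfl⟩ := h
  induction l with
  | nil => simp
  | cons q l ih =>
    rw [List.map_cons, List.sum_cons, map_add]
    exact add_nonneg (hE q (hl q (by simp))) (ih fun q' hq' => hl q' (List.mem_cons_of_mem q hq'))

/-- Soundness: evaluating a certificate at a real point gives a nonnegative number ("this system is sound"). [cite: KauersODonnellTanZhou2012, §1.1 (p. 2)] -/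
theorem eval_nonneg (h : IsSosDeg k p) (v : σ → ℝ) : 0 ≤ MvPolynomial.eval v p := by
  obtain ⟨l, -, rfl⟩ := h
  induction l with
  | nil => simp
  | cons q l ih =>
    rw [List.map_cons, List.sum_cons, map_add, map_pow]
    exact add_nonneg (sq_nonneg _) ih

end IsSosDeg

/-! ### §2 Fourier polynomials with indeterminate coefficients -/

variable {n : ℕ}

/-- `f(x) = Σ_S χ_S(x) · f̂(S)` for a family of coefficient polynomials `a S = f̂(S)` (BBHKSZ p. 9:
"for every fixed `w`, the expression `f(w)` is a linear polynomial over these variables").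
[cite: BarakBrandaoHarrowKelnerSteurerZhou2012, §3.2 (p. 9) and Lemma 5.1 (p. 13)] -/
def fourierPoly (a : Finset (Fin n) → MvPolynomial σ ℝ) (x : Fin n → Bool) : MvPolynomial σ ℝ :=
  ∑ S, C (walsh S x) * a S

/-- `E f² = Σ_S f̂(S)²` (Parseval form). [cite: BarakBrandaoHarrowKelnerSteurerZhou2012, Lemma 5.1 (p. 13)] -/
def sqNorm (a : Finset (Fin n) → MvPolynomial σ ℝ) : MvPolynomial σ ℝ := ∑ S, a S ^ 2

/-- `‖T_{√3} f‖₂² = Σ_S 3^{|S|} f̂(S)²`, the weighted square norm driving the induction.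
[cite: KauersODonnellTanZhou2012, Thm. 3.4 (p. 8)] -/
def sqNorm3 (a : Finset (Fin n) → MvPolynomial σ ℝ) : MvPolynomial σ ℝ :=
  ∑ S, C ((3 : ℝ) ^ S.card) * a S ^ 2

/-- The noise operator on coefficients: `(T_ρ f)^(S) = ρ^{|S|} f̂(S)`.
[cite: KauersODonnellTanZhou2012, §1 (p. 1) and Thm. 3.4 (p. 8)] -/
def noise (ρ : ℝ) (a : Finset (Fin n) → MvPolynomial σ ℝ) : Finset (Fin n) → MvPolynomial σ ℝ :=
  fun S => C (ρ ^ S.card) * a S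

/-- The low-degree projector on coefficients: `(P_d f)^(S) = [|S| ≤ d] f̂(S)`.
[cite: BarakBrandaoHarrowKelnerSteurerZhou2012, Thm. 2.2 (p. 3)] -/
def proj (d : ℕ) (a : Finset (Fin n) → MvPolynomial σ ℝ) : Finset (Fin n) → MvPolynomial σ ℝ :=
  fun S => if S.card ≤ d then a S else 0

/-! #### Splitting off the first coordinate -/

/-- The coefficients not involving coordinate `0`: `f₀^(T) = f̂(T⁺)`. [cite: BarakBrandaoHarrowKelnerSteurerZhou2012, proof of Lemma 5.1 (p. 14)] -/
def lo (a : Finset (Fin (n + 1)) → MvPolynomial σ ℝ) : Finset (Fin n) → MvPolynomial σ ℝ :=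
  fun T => a (T.map (Fin.succEmb n))

/-- The coefficients involving coordinate `0`: `f₁^(T) = f̂({0} ∪ T⁺)`. [cite: BarakBrandaoHarrowKelnerSteurerZhou2012, proof of Lemma 5.1 (p. 14)] -/
def hi (a : Finset (Fin (n + 1)) → MvPolynomial σ ℝ) : Finset (Fin n) → MvPolynomial σ ℝ :=
  fun T => a (insert 0 (T.map (Fin.succEmb n)))

/-- Subsets of an embedded copy are the embedded copies of subsets. [folklore] -/
private theorem powerset_map_eq {α β : Type*} [DecidableEq β] (e : α ↪ β) (s : Finset α) :
    (s.map e).powerset = s.powerset.map (Finset.mapEmbedding e).toEmbedding := by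
  ext t
  simp only [Finset.mem_powerset, Finset.mem_map, RelEmbedding.coe_toEmbedding,
    Finset.mapEmbedding_apply]
  constructor
  · intro h
    obtain ⟨u, hu, rfl⟩ := Finset.subset_map_iff.1 h
    exact ⟨u, hu, rfl⟩
  · rintro ⟨u, hu, rfl⟩
    exact Finset.map_subset_map.2 hu

/-- `Σ_{S ⊆ [n+1]} F(S) = Σ_{T ⊆ [n]} (F(T⁺) + F({0} ∪ T⁺))`. [folklore] -/
private theorem sum_finset_succ {β : Type*} [AddCommMonoid β] (F : Finset (Fin (n + 1)) → β) :
    ∑ S, F S = ∑ T : Finset (Fin n), (F (T.map (Fin.succEmb n)) + F (insert 0 (T.map (Fin.succEmb n)))) := by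
  classical
  have h0 : (0 : Fin (n + 1)) ∉ (Finset.univ : Finset (Fin n)).map (Fin.succEmb n) := by
    simp only [Finset.mem_map, Finset.mem_univ, true_and, not_exists]
    exact fun i => Fin.succ_ne_zero i
  have huniv : (Finset.univ : Finset (Fin (n + 1))) =
      insert 0 ((Finset.univ : Finset (Fin n)).map (Fin.succEmb n)) := by
    rw [Fin.univ_succ, Finset.cons_eq_insert]
    rfl
  rw [← Finset.powerset_univ, huniv, Finset.sum_powerset_insert h0, powerset_map_eq,
    Finset.sum_map, Finset.sum_map, Finset.powerset_univ, ← Finset.sum_add_distrib]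
  rfl

/-- `Σ_{x ∈ {0,1}^{n+1}} F(x) = Σ_{y ∈ {0,1}ⁿ} (F(0,y) + F(1,y))`. [folklore] -/
private theorem sum_cube_succ {β : Type*} [AddCommMonoid β] (F : (Fin (n + 1) → Bool) → β) :
    ∑ x, F x = ∑ y : Fin n → Bool, (F (Fin.cons false y) + F (Fin.cons true y)) := by
  rw [← Fintype.sum_equiv (Fin.consEquiv fun _ : Fin (n + 1) => Bool) (fun p => F (Fin.cons p.1 p.2)) F
    (fun p => rfl), Fintype.sum_prod_type, Fintype.sum_bool, ← sum_add_distrib]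
  exact sum_congr rfl fun y _ => add_comm _ _

/-- **`f(b, y) = f₀(y) + χ(b) f₁(y)`** ("`f = f₀ + xₙ f₁`").
[cite: BarakBrandaoHarrowKelnerSteurerZhou2012, proof of Lemma 5.1 (p. 14)] -/
theorem fourierPoly_cons (a : Finset (Fin (n + 1)) → MvPolynomial σ ℝ) (b : Bool) (y : Fin n → Bool) :
    fourierPoly a (Fin.cons b y) = fourierPoly (lo a) y + C (sgn b) * fourierPoly (hi a) y := by
  unfold fourierPoly lo hi
  rw [sum_finset_succ, sum_add_distrib, Finset.mul_sum]
  congr 1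
  · exact sum_congr rfl fun T _ => by rw [walsh_map_succEmb_cons]
  · exact sum_congr rfl fun T _ => by rw [walsh_insert_zero_cons, map_mul, mul_assoc]

/-- **`‖T_{√3} f‖² = ‖T_{√3} f₀‖² + 3‖T_{√3} f₁‖²`.** [cite: KauersODonnellTanZhou2012, proof of Thm. 3.4 (p. 9)] -/
theorem sqNorm3_succ (a : Finset (Fin (n + 1)) → MvPolynomial σ ℝ) :
    sqNorm3 a = sqNorm3 (lo a) + 3 * sqNorm3 (hi a) := by
  unfold sqNorm3 lo hi
  rw [sum_finset_succ, sum_add_distrib, Finset.mul_sum]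
  congr 1
  · exact sum_congr rfl fun T _ => by rw [card_map]
  · exact sum_congr rfl fun T _ => by
      rw [card_insert_zero_map_succEmb, pow_succ, map_mul, map_ofNat]
      ring

/-- `‖f‖² = ‖f₀‖² + ‖f₁‖²`. [cite: BarakBrandaoHarrowKelnerSteurerZhou2012, proof of Lemma 5.1 (p. 14)] -/
theorem sqNorm_succ (a : Finset (Fin (n + 1)) → MvPolynomial σ ℝ) :
    sqNorm a = sqNorm (lo a) + sqNorm (hi a) := by
  unfold sqNorm lo hi
  rw [sum_finset_succ, sum_add_distrib]

/-! #### Degree bookkeeping -/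

/-- Entries of degree `≤ 1` pass to `f₀`. [folklore] -/
private theorem lo_deg {a : Finset (Fin (n + 1)) → MvPolynomial σ ℝ} (ha : ∀ S, (a S).totalDegree ≤ 1) (T) :
    (lo a T).totalDegree ≤ 1 := ha _

/-- Entries of degree `≤ 1` pass to `f₁`. [folklore] -/
private theorem hi_deg {a : Finset (Fin (n + 1)) → MvPolynomial σ ℝ} (ha : ∀ S, (a S).totalDegree ≤ 1) (T) :
    (hi a T).totalDegree ≤ 1 := ha _

/-- `f(x)` is linear in the coefficients. [cite: BarakBrandaoHarrowKelnerSteurerZhou2012, Remark 3.6 (p. 9)] -/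
theorem totalDegree_fourierPoly_le {a : Finset (Fin n) → MvPolynomial σ ℝ}
    (ha : ∀ S, (a S).totalDegree ≤ 1) (x : Fin n → Bool) : (fourierPoly a x).totalDegree ≤ 1 := by
  unfold fourierPoly
  refine (totalDegree_finsetSum _ _).trans (Finset.sup_le fun S _ => ?_)
  exact (totalDegree_mul _ _).trans (by simpa using ha S)

/-- Products of two linear expressions have degree `≤ 2`. [folklore] -/
private theorem totalDegree_mul_le_two {p q : MvPolynomial σ ℝ} (hp : p.totalDegree ≤ 1)
    (hq : q.totalDegree ≤ 1) : (p * q).totalDegree ≤ 2 :=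
  (totalDegree_mul _ _).trans (by omega)

/-- Multiplying by a constant does not raise the degree. [folklore] -/
private theorem totalDegree_C_mul_le (c : ℝ) (p : MvPolynomial σ ℝ) : (C c * p).totalDegree ≤ p.totalDegree :=
  (totalDegree_mul _ _).trans (by rw [totalDegree_C, zero_add])

/-- A weighted product of two square norms with nonnegative weights is a sum of squares of
degree-`2` polynomials: `(Σ_S c_S a_S²)(Σ_U d_U b_U²) = Σ_{S,U} (√(c_S d_U)·a_S b_U)²`. [folklore] -/
private theorem isSosDeg_weighted_mul {ι κ : Type*} (s : Finset ι) (t : Finset κ)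
    {a : ι → MvPolynomial σ ℝ} {b : κ → MvPolynomial σ ℝ} {c : ι → ℝ} {d : κ → ℝ}
    (ha : ∀ i ∈ s, (a i).totalDegree ≤ 1) (hb : ∀ j ∈ t, (b j).totalDegree ≤ 1)
    (hc : ∀ i ∈ s, 0 ≤ c i) (hd : ∀ j ∈ t, 0 ≤ d j) :
    IsSosDeg 2 ((∑ i ∈ s, C (c i) * a i ^ 2) * ∑ j ∈ t, C (d j) * b j ^ 2) := by
  rw [Finset.sum_mul_sum]
  refine IsSosDeg.sum _ fun i hi => IsSosDeg.sum _ fun j hj => ?_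
  have e : C (c i) * a i ^ 2 * (C (d j) * b j ^ 2) = C (c i * d j) * (a i * b j) ^ 2 := by
    rw [map_mul]; ring
  rw [e]
  exact (IsSosDeg.sq (totalDegree_mul_le_two (ha i hi) (hb j hj))).const_mul
    (mul_nonneg (hc i hi) (hd j hj))

/-! ### §3 The induction (BBHKSZ eq. (5.1); KOTZ Theorem 3.4 with `s = 2`) -/

/-- The one-coordinate identity behind eq. (5.1): averaging over the sign of `xₙ`,
`(u₀+u₁)²(v₀+v₁)² + (u₀−u₁)²(v₀−v₁)² = 2(u₀²v₀² + u₁²v₁² + 3u₀²v₁² + 3u₁²v₀²) − 4(u₀v₁ − u₁v₀)²`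
("by expanding the square expression … we get `4E f₀f₁g₀g₁ ⪯ 2E f₀²g₁² + f₁²g₀²`"; the square
printed there, `(f₀f₁ − g₀g₁)²`, should read `(f₀g₁ − f₁g₀)²`, which is the one used here).
[cite: BarakBrandaoHarrowKelnerSteurerZhou2012, proof of Lemma 5.1, eq. (5.1) (p. 14)] -/
theorem one_coordinate_identity (u₀ u₁ v₀ v₁ : MvPolynomial σ ℝ) :
    (u₀ + u₁) ^ 2 * (v₀ + v₁) ^ 2 + (u₀ - u₁) ^ 2 * (v₀ - v₁) ^ 2 =
      2 * (u₀ ^ 2 * v₀ ^ 2 + u₁ ^ 2 * v₁ ^ 2 + 3 * (u₀ ^ 2 * v₁ ^ 2) + 3 * (u₁ ^ 2 * v₀ ^ 2)) -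
        4 * (u₀ * v₁ - u₁ * v₀) ^ 2 := by
  ring

/-- **KOTZ Theorem 3.4 (`s = 2`, Rademacher bits), cleared denominators / BBHKSZ's induction.**
For coefficient families `a = (f̂(S))_S`, `b = (ĝ(U))_U` of polynomials of degree `≤ 1`,
`2ⁿ · (Σ_S 3^{|S|} f̂(S)²)(Σ_U 3^{|U|} ĝ(U)²) − Σ_{x ∈ {0,1}ⁿ} f(x)² g(x)²`
is a sum of squares of polynomials of degree `≤ 2` in the coefficients — i.e.
`⊢₄ E[f²g²] ≤ ‖T_{√3}f‖₂²·‖T_{√3}g‖₂²`, equivalently `⊢₄ E[(T_ρ f)²(T_ρ g)²] ≤ E f²·E g²` at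
`ρ = 1/√3` (`two_function_sos_hypercontractivity_noise_rho` below for `0 ≤ ρ ≤ 1/√3`).  Induction on
`n`: `f = f₀ + xₙf₁`, `‖T_{√3}f‖² = ‖T_{√3}f₀‖² + 3‖T_{√3}f₁‖²`, the one-coordinate identity, and the
induction hypothesis for the four pairs `(fᵢ, gⱼ)`; the slack is `2^{n+1}·8·‖T f₁‖²‖T g₁‖² +
4 Σ_y (f₀g₁ − f₁g₀)(y)²`. [cite: KauersODonnellTanZhou2012, Thm. 3.4 (p. 8–9), case s = 2]
[cite: BarakBrandaoHarrowKelnerSteurerZhou2012, proof of Lemma 5.1 (p. 13–14)] -/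
theorem two_function_sos_hypercontractivity_noise :
    ∀ {n : ℕ} (a b : Finset (Fin n) → MvPolynomial σ ℝ), (∀ S, (a S).totalDegree ≤ 1) →
      (∀ S, (b S).totalDegree ≤ 1) →
      IsSosDeg 2 (C ((2 : ℝ) ^ n) * (sqNorm3 a * sqNorm3 b) -
        ∑ x, fourierPoly a x ^ 2 * fourierPoly b x ^ 2) := by
  intro n
  induction n with
  | zero =>
    intro a b _ _
    have h : C ((2 : ℝ) ^ 0) * (sqNorm3 a * sqNorm3 b) -
        ∑ x, fourierPoly a x ^ 2 * fourierPoly b x ^ 2 = 0 := by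
      simp only [sqNorm3, fourierPoly, Fintype.sum_unique, pow_zero, map_one, one_mul]
      have h1 : (default : Finset (Fin 0)) = ∅ := Subsingleton.elim _ _
      rw [h1, card_empty, pow_zero, map_one, one_mul, one_mul, walsh_empty, map_one, one_mul, one_mul,
        sub_self]
    rw [h]
    exact IsSosDeg.zero 2
  | succ n ih =>
    intro a b ha hb
    -- the four instances of the induction hypothesis
    have h00 := ih (lo a) (lo b) (lo_deg ha) (lo_deg hb)
    have h01 := ih (lo a) (hi b) (lo_deg ha) (hi_deg hb)
    have h10 := ih (hi a) (lo b) (hi_deg ha) (lo_deg hb)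
    have h11 := ih (hi a) (hi b) (hi_deg ha) (hi_deg hb)
    -- the slack terms
    have hAB : IsSosDeg 2 (C ((2 : ℝ) ^ n * 8) * (sqNorm3 (hi a) * sqNorm3 (hi b))) :=
      (isSosDeg_weighted_mul _ _ (fun T _ => hi_deg ha T) (fun T _ => hi_deg hb T)
        (fun T _ => by positivity) (fun T _ => by positivity)).const_mul (by positivity)
    have hsq : IsSosDeg 2 (∑ y : Fin n → Bool,
        (fourierPoly (lo a) y * fourierPoly (hi b) y - fourierPoly (hi a) y * fourierPoly (lo b) y) ^ 2) := by
      refine IsSosDeg.sum _ fun y _ => IsSosDeg.sq ?_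
      refine (totalDegree_sub _ _).trans (max_le ?_ ?_)
      · exact totalDegree_mul_le_two (totalDegree_fourierPoly_le (lo_deg ha) y)
          (totalDegree_fourierPoly_le (hi_deg hb) y)
      · exact totalDegree_mul_le_two (totalDegree_fourierPoly_le (hi_deg ha) y)
          (totalDegree_fourierPoly_le (lo_deg hb) y)
    -- assembling
    have hsum : ∑ x, fourierPoly a x ^ 2 * fourierPoly b x ^ 2 =
        2 * (∑ y, fourierPoly (lo a) y ^ 2 * fourierPoly (lo b) y ^ 2 +
              ∑ y, fourierPoly (hi a) y ^ 2 * fourierPoly (hi b) y ^ 2 +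
              3 * ∑ y, fourierPoly (lo a) y ^ 2 * fourierPoly (hi b) y ^ 2 +
              3 * ∑ y, fourierPoly (hi a) y ^ 2 * fourierPoly (lo b) y ^ 2) -
          4 * ∑ y, (fourierPoly (lo a) y * fourierPoly (hi b) y -
                fourierPoly (hi a) y * fourierPoly (lo b) y) ^ 2 := by
      rw [sum_cube_succ]
      have hpt : ∀ y : Fin n → Bool,
          fourierPoly a (Fin.cons false y) ^ 2 * fourierPoly b (Fin.cons false y) ^ 2 +
            fourierPoly a (Fin.cons true y) ^ 2 * fourierPoly b (Fin.cons true y) ^ 2 =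
          2 * (fourierPoly (lo a) y ^ 2 * fourierPoly (lo b) y ^ 2 +
                fourierPoly (hi a) y ^ 2 * fourierPoly (hi b) y ^ 2 +
                3 * (fourierPoly (lo a) y ^ 2 * fourierPoly (hi b) y ^ 2) +
                3 * (fourierPoly (hi a) y ^ 2 * fourierPoly (lo b) y ^ 2)) -
            4 * (fourierPoly (lo a) y * fourierPoly (hi b) y -
                fourierPoly (hi a) y * fourierPoly (lo b) y) ^ 2 := by
        intro y
        rw [fourierPoly_cons, fourierPoly_cons, fourierPoly_cons, fourierPoly_cons, sgn_false, sgn_true,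
          map_one, one_mul, one_mul, map_neg, map_one, neg_one_mul, neg_one_mul, ← sub_eq_add_neg,
          ← sub_eq_add_neg]
        exact one_coordinate_identity _ _ _ _
      rw [sum_congr rfl fun y _ => hpt y, sum_sub_distrib, ← mul_sum, ← mul_sum, sum_add_distrib,
        sum_add_distrib, sum_add_distrib, ← mul_sum, ← mul_sum]
    have key : C ((2 : ℝ) ^ (n + 1)) * (sqNorm3 a * sqNorm3 b) -
        ∑ x, fourierPoly a x ^ 2 * fourierPoly b x ^ 2 =
        2 * ((C ((2 : ℝ) ^ n) * (sqNorm3 (lo a) * sqNorm3 (lo b)) -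
                ∑ y, fourierPoly (lo a) y ^ 2 * fourierPoly (lo b) y ^ 2) +
             3 * (C ((2 : ℝ) ^ n) * (sqNorm3 (lo a) * sqNorm3 (hi b)) -
                ∑ y, fourierPoly (lo a) y ^ 2 * fourierPoly (hi b) y ^ 2) +
             3 * (C ((2 : ℝ) ^ n) * (sqNorm3 (hi a) * sqNorm3 (lo b)) -
                ∑ y, fourierPoly (hi a) y ^ 2 * fourierPoly (lo b) y ^ 2) +
             (C ((2 : ℝ) ^ n) * (sqNorm3 (hi a) * sqNorm3 (hi b)) -
                ∑ y, fourierPoly (hi a) y ^ 2 * fourierPoly (hi b) y ^ 2) +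
             C ((2 : ℝ) ^ n * 8) * (sqNorm3 (hi a) * sqNorm3 (hi b))) +
        4 * ∑ y, (fourierPoly (lo a) y * fourierPoly (hi b) y -
              fourierPoly (hi a) y * fourierPoly (lo b) y) ^ 2 := by
      rw [hsum, sqNorm3_succ a, sqNorm3_succ b, pow_succ, map_mul, map_mul, map_ofNat, map_ofNat]
      ring
    rw [key]
    refine IsSosDeg.add ?_ ?_
    · have h2 := ((((h00.add (h01.nsmul 3)).add (h10.nsmul 3)).add h11).add hAB).nsmul 2
      simp only [nsmul_eq_mul, Nat.cast_ofNat] at h2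
      exact h2
    · have h4 := hsq.nsmul 4
      simp only [nsmul_eq_mul, Nat.cast_ofNat] at h4
      exact h4

/-! ### §4 The printed statements -/

/-- Comparing two weighted products of square norms termwise: if `0 ≤ c' ≤ c` and `0 ≤ d' ≤ d` then
`(Σ c_S a_S²)(Σ d_U b_U²) − (Σ c'_S a_S²)(Σ d'_U b_U²) = Σ_{S,U} (c_S d_U − c'_S d'_U)(a_S b_U)²` is a sum of
squares of degree-`2` polynomials. [folklore] -/
private theorem isSosDeg_weighted_mul_sub {ι κ : Type*} (s : Finset ι) (t : Finset κ)
    {a : ι → MvPolynomial σ ℝ} {b : κ → MvPolynomial σ ℝ} {c c' : ι → ℝ} {d d' : κ → ℝ}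
    (ha : ∀ i ∈ s, (a i).totalDegree ≤ 1) (hb : ∀ j ∈ t, (b j).totalDegree ≤ 1)
    (hc : ∀ i ∈ s, c' i ≤ c i) (hc' : ∀ i ∈ s, 0 ≤ c' i) (hd : ∀ j ∈ t, d' j ≤ d j)
    (hd' : ∀ j ∈ t, 0 ≤ d' j) :
    IsSosDeg 2 ((∑ i ∈ s, C (c i) * a i ^ 2) * (∑ j ∈ t, C (d j) * b j ^ 2) -
      (∑ i ∈ s, C (c' i) * a i ^ 2) * (∑ j ∈ t, C (d' j) * b j ^ 2)) := by
  rw [Finset.sum_mul_sum, Finset.sum_mul_sum, ← Finset.sum_sub_distrib]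
  refine IsSosDeg.sum _ fun i hi => ?_
  rw [← Finset.sum_sub_distrib]
  refine IsSosDeg.sum _ fun j hj => ?_
  have e : C (c i) * a i ^ 2 * (C (d j) * b j ^ 2) - C (c' i) * a i ^ 2 * (C (d' j) * b j ^ 2) =
      C (c i * d j - c' i * d' j) * (a i * b j) ^ 2 := by
    rw [map_sub, map_mul, map_mul]; ring
  rw [e]
  refine (IsSosDeg.sq (totalDegree_mul_le_two (ha i hi) (hb j hj))).const_mul ?_
  exact sub_nonneg.2 (mul_le_mul (hc i hi) (hd j hj) (hd' j hj) ((hc' i hi).trans (hc i hi)))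

/-- **Parseval in the coefficient ring**: `E_x f(x)² = Σ_S f̂(S)²` as polynomials in the coefficients
("`E f₀² + E f₁² = E (f₀ + xₙf₁)² = E f²`", p. 14). [cite: BarakBrandaoHarrowKelnerSteurerZhou2012, proof of Lemma 5.1 (p. 14)] -/
theorem expect_fourierPoly_sq (a : Finset (Fin n) → MvPolynomial σ ℝ) :
    C ((2 : ℝ) ^ n)⁻¹ * ∑ x, fourierPoly a x ^ 2 = sqNorm a := by
  have key : ∑ x, fourierPoly a x ^ 2 = C ((2 : ℝ) ^ n) * sqNorm a := by
    unfold fourierPoly sqNorm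
    have e1 : ∀ x : Fin n → Bool, (∑ S, C (walsh S x) * a S) ^ 2 =
        ∑ S, ∑ T, C (walsh S x * walsh T x) * (a S * a T) := by
      intro x
      rw [pow_two, Finset.sum_mul_sum]
      refine sum_congr rfl fun S _ => sum_congr rfl fun T _ => ?_
      rw [map_mul]; ring
    rw [sum_congr rfl fun x _ => e1 x, Finset.sum_comm]
    simp_rw [Finset.sum_comm (s := (Finset.univ : Finset (Fin n → Bool))), ← Finset.sum_mul, ← map_sum,
      Literature.Computability.Complexity.LowDegree.sum_walsh_mul_walsh_index]
    rw [Finset.mul_sum]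
    refine sum_congr rfl fun S _ => ?_
    rw [Finset.sum_eq_single S (fun T _ hT => by rw [if_neg (Ne.symm hT), map_zero, zero_mul])
      (fun h => absurd (mem_univ S) h), if_pos rfl, pow_two]
  rw [key, ← mul_assoc, ← map_mul, inv_mul_cancel₀ (by positivity), map_one, one_mul]

/-- **KOTZ Theorem 3.4 (`s = 2`), as printed**: for `0 ≤ ρ ≤ 1/√3` and Fourier polynomials `f, g`
with indeterminate coefficients (entries of degree `≤ 1`),
`⊢₄ E[(T_ρ f)²(T_ρ g)²] ≤ E[f²]·E[g²]`, i.e. `E f²·E g² − E_x (T_ρf)(x)²(T_ρg)(x)²` is a sum of squares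
of polynomials of degree `≤ 2` (`E f² = Σ_S f̂(S)²` by `expect_fourierPoly_sq`).
[cite: KauersODonnellTanZhou2012, Thm. 3.4 (p. 8, eq. (3)), case s = 2] -/
theorem two_function_sos_hypercontractivity_noise_rho {ρ : ℝ} (hρ : 0 ≤ ρ) (hρ' : ρ ≤ 1 / Real.sqrt 3)
    (a b : Finset (Fin n) → MvPolynomial σ ℝ) (ha : ∀ S, (a S).totalDegree ≤ 1)
    (hb : ∀ S, (b S).totalDegree ≤ 1) :
    IsSosDeg 2 (sqNorm a * sqNorm b -
      C ((2 : ℝ) ^ n)⁻¹ * ∑ x, fourierPoly (noise ρ a) x ^ 2 * fourierPoly (noise ρ b) x ^ 2) := by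
  -- `3ρ² ≤ 1`
  have h3 : 3 * ρ ^ 2 ≤ 1 := by
    have hs : (0 : ℝ) < Real.sqrt 3 := Real.sqrt_pos.2 (by norm_num)
    have h1 : ρ * Real.sqrt 3 ≤ 1 := by
      calc ρ * Real.sqrt 3 ≤ 1 / Real.sqrt 3 * Real.sqrt 3 := mul_le_mul_of_nonneg_right hρ' hs.le
        _ = 1 := by rw [one_div, inv_mul_cancel₀ hs.ne']
    have h2 : (ρ * Real.sqrt 3) ^ 2 ≤ 1 := by
      have h0 : 0 ≤ ρ * Real.sqrt 3 := mul_nonneg hρ hs.le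
      nlinarith
    rw [mul_pow, Real.sq_sqrt (by norm_num)] at h2
    linarith
  have hna : ∀ S, (noise ρ a S).totalDegree ≤ 1 := fun S => (totalDegree_C_mul_le _ _).trans (ha S)
  have hnb : ∀ S, (noise ρ b S).totalDegree ≤ 1 := fun S => (totalDegree_C_mul_le _ _).trans (hb S)
  have hcore := (two_function_sos_hypercontractivity_noise (noise ρ a) (noise ρ b) hna hnb).const_mul
    (c := ((2 : ℝ) ^ n)⁻¹) (by positivity)
  have e1 : C ((2 : ℝ) ^ n)⁻¹ * (C ((2 : ℝ) ^ n) * (sqNorm3 (noise ρ a) * sqNorm3 (noise ρ b)) -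
      ∑ x, fourierPoly (noise ρ a) x ^ 2 * fourierPoly (noise ρ b) x ^ 2) =
      sqNorm3 (noise ρ a) * sqNorm3 (noise ρ b) -
        C ((2 : ℝ) ^ n)⁻¹ * ∑ x, fourierPoly (noise ρ a) x ^ 2 * fourierPoly (noise ρ b) x ^ 2 := by
    rw [mul_sub, ← mul_assoc, ← map_mul, inv_mul_cancel₀ (by positivity), map_one, one_mul]
  rw [e1] at hcore
  -- the weights `(3ρ²)^{|S|} ≤ 1`
  have ew : ∀ (c : Finset (Fin n) → MvPolynomial σ ℝ), sqNorm3 (noise ρ c) =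
      ∑ S, C ((3 * ρ ^ 2) ^ S.card) * c S ^ 2 := by
    intro c
    unfold sqNorm3 noise
    refine sum_congr rfl fun S _ => ?_
    rw [mul_pow, ← map_pow, ← mul_assoc, ← map_mul, ← pow_mul, mul_pow, ← pow_mul']
  have e1' : ∀ (c : Finset (Fin n) → MvPolynomial σ ℝ), sqNorm c = ∑ S, C (1 : ℝ) * c S ^ 2 := by
    intro c; unfold sqNorm; simp
  have hcmp : IsSosDeg 2 (sqNorm a * sqNorm b - sqNorm3 (noise ρ a) * sqNorm3 (noise ρ b)) := by
    rw [ew, ew, e1' a, e1' b]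
    refine isSosDeg_weighted_mul_sub _ _ (fun S _ => ha S) (fun S _ => hb S)
      (fun S _ => pow_le_one₀ (by positivity) h3) (fun S _ => by positivity)
      (fun S _ => pow_le_one₀ (by positivity) h3) (fun S _ => by positivity)
  have := hcmp.add hcore
  rwa [sub_add_sub_cancel] at this

/-- **BBHKSZ, the two-function hypercontractivity in SoS** (proof of Lemma 5.1, p. 13): "for `f` and
`g` being `n`-variate Fourier polynomials with degrees at most `d` and `e`, it holds that
`E f²g² ⪯ 9^{(d+e)/2}(E f²)(E g²)`" — `9^{(d+e)/2} = 3^{d+e}`; `⪯` = the difference is a sum of squares of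
polynomials of degree `≤ 2` in the coefficients (entries `f̂(S) = a S`, `ĝ(U) = b U` of degree `≤ 1`,
vanishing for `|S| > d`, `|U| > e`). [cite: BarakBrandaoHarrowKelnerSteurerZhou2012, proof of Lemma 5.1 (p. 13)] -/
theorem two_function_sos_hypercontractivity {d e : ℕ} (a b : Finset (Fin n) → MvPolynomial σ ℝ)
    (ha : ∀ S, (a S).totalDegree ≤ 1) (hb : ∀ S, (b S).totalDegree ≤ 1)
    (had : ∀ S, d < S.card → a S = 0) (hbe : ∀ S, e < S.card → b S = 0) :
    IsSosDeg 2 (C ((3 : ℝ) ^ (d + e)) * (sqNorm a * sqNorm b) -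
      C ((2 : ℝ) ^ n)⁻¹ * ∑ x, fourierPoly a x ^ 2 * fourierPoly b x ^ 2) := by
  classical
  have hcore := (two_function_sos_hypercontractivity_noise a b ha hb).const_mul
    (c := ((2 : ℝ) ^ n)⁻¹) (by positivity)
  have e1 : C ((2 : ℝ) ^ n)⁻¹ * (C ((2 : ℝ) ^ n) * (sqNorm3 a * sqNorm3 b) -
      ∑ x, fourierPoly a x ^ 2 * fourierPoly b x ^ 2) =
      sqNorm3 a * sqNorm3 b - C ((2 : ℝ) ^ n)⁻¹ * ∑ x, fourierPoly a x ^ 2 * fourierPoly b x ^ 2 := by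
    rw [mul_sub, ← mul_assoc, ← map_mul, inv_mul_cancel₀ (by positivity), map_one, one_mul]
  rw [e1] at hcore
  -- restrict the weights to the supports
  have ew : ∀ (c : Finset (Fin n) → MvPolynomial σ ℝ) (k : ℕ), (∀ S, k < S.card → c S = 0) →
      sqNorm3 c = ∑ S, C (if S.card ≤ k then (3 : ℝ) ^ S.card else 0) * c S ^ 2 := by
    intro c k hc
    unfold sqNorm3
    refine sum_congr rfl fun S _ => ?_
    by_cases h : S.card ≤ k
    · rw [if_pos h]
    · rw [if_neg h, hc S (not_le.1 h)]; simp
  have ec : ∀ (c : Finset (Fin n) → MvPolynomial σ ℝ) (k : ℕ),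
      C ((3 : ℝ) ^ k) * sqNorm c = ∑ S, C ((3 : ℝ) ^ k) * c S ^ 2 := by
    intro c k; unfold sqNorm; rw [Finset.mul_sum]
  have hcmp : IsSosDeg 2 (C ((3 : ℝ) ^ (d + e)) * (sqNorm a * sqNorm b) - sqNorm3 a * sqNorm3 b) := by
    rw [pow_add, map_mul, show C ((3 : ℝ) ^ d) * C ((3 : ℝ) ^ e) * (sqNorm a * sqNorm b) =
      (C ((3 : ℝ) ^ d) * sqNorm a) * (C ((3 : ℝ) ^ e) * sqNorm b) by ring, ec, ec, ew a d had, ew b e hbe]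
    refine isSosDeg_weighted_mul_sub _ _ (fun S _ => ha S) (fun S _ => hb S) (fun S _ => ?_)
      (fun S _ => ?_) (fun S _ => ?_) (fun S _ => ?_)
    · split_ifs with h
      · exact pow_le_pow_right₀ (by norm_num) h
      · positivity
    · split_ifs <;> positivity
    · split_ifs with h
      · exact pow_le_pow_right₀ (by norm_num) h
      · positivity
    · split_ifs <;> positivity
  have := hcmp.add hcore
  rwa [sub_add_sub_cancel] at this

/-- **BBHKSZ Lemma 5.1 / eq. (3.3): hypercontractivity of low-degree polynomials in SoS.** "Over the
space of `n`-variate Fourier polynomials `f` with degree at most `d`, `E f⁴ ⪯ 9^d (E f²)²`", i.e.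
"`9^d (E_w f(w)²)² = E_w f(w)⁴ + Σᵢ Qᵢ(f)²` where the `Qᵢ`'s are polynomials of degree `≤ 2` in the
variables `{f̂(α)}` specifying the coefficients of `f`" (here `E f² = Σ_S f̂(S)²`, `expect_fourierPoly_sq`).
[cite: BarakBrandaoHarrowKelnerSteurerZhou2012, Lemma 5.1 (p. 13) and eq. (3.3) (p. 9)] -/
theorem sos_hypercontractivity {d : ℕ} (a : Finset (Fin n) → MvPolynomial σ ℝ)
    (ha : ∀ S, (a S).totalDegree ≤ 1) (had : ∀ S, d < S.card → a S = 0) :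
    IsSosDeg 2 (C ((9 : ℝ) ^ d) * sqNorm a ^ 2 - C ((2 : ℝ) ^ n)⁻¹ * ∑ x, fourierPoly a x ^ 4) := by
  have h := two_function_sos_hypercontractivity a a ha ha had had
  have e9 : (3 : ℝ) ^ (d + d) = 9 ^ d := by rw [← two_mul, pow_mul]; norm_num
  rw [e9, ← pow_two] at h
  convert h using 3
  exact sum_congr rfl fun x _ => by ring

/-- **BBHKSZ eq. (3.3) literally**: with one indeterminate `f̂(α)` for each `α ⊆ [n]`, `|α| ≤ d`,
`9^d (Σ_α f̂(α)²)² − E_w (Σ_α f̂(α)χ_α(w))⁴ = Σᵢ Qᵢ²` with `deg Qᵢ ≤ 2`.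
[cite: BarakBrandaoHarrowKelnerSteurerZhou2012, eq. (3.3) (p. 9)] -/
theorem sos_hypercontractivity_eq33 (n d : ℕ) :
    IsSosDeg 2 (C ((9 : ℝ) ^ d) * (∑ v : {S : Finset (Fin n) // S.card ≤ d}, X v ^ 2) ^ 2 -
      C ((2 : ℝ) ^ n)⁻¹ * ∑ x : Fin n → Bool,
        (∑ v : {S : Finset (Fin n) // S.card ≤ d}, C (walsh v.1 x) * X v) ^ 4 :
      MvPolynomial {S : Finset (Fin n) // S.card ≤ d} ℝ) := by
  classical
  set a : Finset (Fin n) → MvPolynomial {S : Finset (Fin n) // S.card ≤ d} ℝ :=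
    fun S => if h : S.card ≤ d then X ⟨S, h⟩ else 0 with ha_def
  have ha : ∀ S, (a S).totalDegree ≤ 1 := by
    intro S
    simp only [ha_def]
    split_ifs
    · exact (totalDegree_X _).le
    · simp
  have had : ∀ S, d < S.card → a S = 0 := fun S hS => by
    simp only [ha_def]; rw [dif_neg (not_le.2 hS)]
  have h := sos_hypercontractivity a ha had
  have hre : ∀ (F : Finset (Fin n) → MvPolynomial {S : Finset (Fin n) // S.card ≤ d} ℝ →
      MvPolynomial {S : Finset (Fin n) // S.card ≤ d} ℝ), (∀ S, F S 0 = 0) →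
      ∑ S, F S (a S) = ∑ v : {S : Finset (Fin n) // S.card ≤ d}, F v.1 (X v) := by
    intro F hF
    have e : ∑ S, F S (a S) = ∑ S ∈ Finset.univ.filter (fun S : Finset (Fin n) => S.card ≤ d), F S (a S) := by
      rw [Finset.sum_filter]
      refine sum_congr rfl fun S _ => ?_
      split_ifs with hS
      · rfl
      · rw [show a S = 0 from had S (not_le.1 hS), hF]
    rw [e, Finset.sum_subtype (Finset.univ.filter fun S : Finset (Fin n) => S.card ≤ d)
      (p := fun S : Finset (Fin n) => S.card ≤ d) (fun S => by simp)]
    refine sum_congr rfl fun v _ => ?_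
    simp only [ha_def, dif_pos v.2]
  have e1 : sqNorm a = ∑ v : {S : Finset (Fin n) // S.card ≤ d}, X v ^ 2 :=
    hre (fun _ p => p ^ 2) (fun _ => by simp)
  have e2 : ∀ x : Fin n → Bool, fourierPoly a x =
      ∑ v : {S : Finset (Fin n) // S.card ≤ d}, C (walsh v.1 x) * X v :=
    fun x => hre (fun S p => C (walsh S x) * p) (fun _ => by simp)
  rw [e1] at h
  simp_rw [e2] at h
  exact h

/-- **BBHKSZ Theorem 2.2 / KOTZ Theorem 1.1 in SoS: `⊢₄ ‖P_d f‖₄⁴ ≤ 9^d ‖f‖₂⁴`.** With an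
indeterminate `f̂(S) = X_S` for EVERY `S ⊆ [n]` and `P_d f = Σ_{|S| ≤ d} f̂(S) χ_S`, the polynomial
`9^d (Σ_S f̂(S)²)² − E_x (P_d f)(x)⁴` is a sum of squares of polynomials of degree `≤ 2` ("the SoS
relaxation certifies that `‖P_d‖_{2→4} ≤ 9^{d/4}`"; "Tensor-SDP(P_d) ≤ 9^d").
[cite: BarakBrandaoHarrowKelnerSteurerZhou2012, Thm. 2.2 (p. 3) and §3.2 (p. 9)]
[cite: KauersODonnellTanZhou2012, Thm. 1.4 and its corollaries (p. 3)] -/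
theorem sos_hypercontractivity_projector (n d : ℕ) :
    IsSosDeg 2 (C ((9 : ℝ) ^ d) * (∑ S : Finset (Fin n), X S ^ 2) ^ 2 -
      C ((2 : ℝ) ^ n)⁻¹ * ∑ x, fourierPoly (proj d fun S => X S) x ^ 4 :
      MvPolynomial (Finset (Fin n)) ℝ) := by
  classical
  have hX : ∀ S : Finset (Fin n), (X S : MvPolynomial (Finset (Fin n)) ℝ).totalDegree ≤ 1 :=
    fun S => (totalDegree_X _).le
  have ha : ∀ S, (proj d (fun S => (X S : MvPolynomial (Finset (Fin n)) ℝ)) S).totalDegree ≤ 1 := by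
    intro S; unfold proj; split_ifs
    · exact hX S
    · simp
  have had : ∀ S, d < S.card → proj d (fun S => (X S : MvPolynomial (Finset (Fin n)) ℝ)) S = 0 :=
    fun S hS => if_neg (not_le.2 hS)
  have h := sos_hypercontractivity _ ha had
  -- `‖f‖₂⁴ − ‖P_d f‖₂⁴` is a sum of squares
  have ew : sqNorm (proj d fun S => (X S : MvPolynomial (Finset (Fin n)) ℝ)) =
      ∑ S, C (if S.card ≤ d then (1 : ℝ) else 0) * X S ^ 2 := by
    unfold sqNorm proj
    refine sum_congr rfl fun S _ => ?_
    split_ifs <;> simp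
  have e1 : (∑ S : Finset (Fin n), (X S : MvPolynomial (Finset (Fin n)) ℝ) ^ 2) =
      ∑ S, C (1 : ℝ) * X S ^ 2 := by simp
  have hcmp : IsSosDeg 2 ((∑ S : Finset (Fin n), (X S : MvPolynomial (Finset (Fin n)) ℝ) ^ 2) ^ 2 -
      sqNorm (proj d fun S => (X S : MvPolynomial (Finset (Fin n)) ℝ)) ^ 2) := by
    rw [pow_two, pow_two, ew, e1]
    refine isSosDeg_weighted_mul_sub _ _ (fun S _ => hX S) (fun S _ => hX S) (fun S _ => ?_)
      (fun S _ => ?_) (fun S _ => ?_) (fun S _ => ?_) <;> split_ifs <;> norm_num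
  have := (hcmp.const_mul (c := (9 : ℝ) ^ d) (by positivity)).add h
  rwa [mul_sub, sub_add_sub_cancel] at this

/-- **KOTZ, SoS proof of `‖T_ρ f‖₄⁴ ≤ ‖f‖₂⁴`** (`0 ≤ ρ ≤ 1/√3`; the case `f = g` of Theorem 3.4,
`s = 2`): `(Σ_S f̂(S)²)² − E_x (T_ρ f)(x)⁴` is a sum of squares of degree-`2` polynomials.
[cite: KauersODonnellTanZhou2012, Thm. 1.4 and the sentence following it (p. 3); Thm. 3.4 (p. 8)] -/
theorem sos_hypercontractivity_noise_self {ρ : ℝ} (hρ : 0 ≤ ρ) (hρ' : ρ ≤ 1 / Real.sqrt 3)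
    (a : Finset (Fin n) → MvPolynomial σ ℝ) (ha : ∀ S, (a S).totalDegree ≤ 1) :
    IsSosDeg 2 (sqNorm a ^ 2 - C ((2 : ℝ) ^ n)⁻¹ * ∑ x, fourierPoly (noise ρ a) x ^ 4) := by
  have h := two_function_sos_hypercontractivity_noise_rho hρ hρ' a a ha ha
  rw [← pow_two] at h
  convert h using 3
  exact sum_congr rfl fun x _ => by ring

/-- **The consumer form of Theorem 2.2 (what a degree-4 pseudo-expectation sees).** Every linear
functional `Ẽ` on the polynomials in the coefficients `(f̂(S))_{S ⊆ [n]}` that is nonnegative on squares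
of polynomials of degree `≤ 2` satisfies `Ẽ[E_x (P_d f)(x)⁴] ≤ 9^d · Ẽ[(Σ_S f̂(S)²)²]` — "(3.3) implies
that (3.2) holds even in the `4`-round SoS relaxation where we consider the coefficients of `f` to be
given by `4`-f.r.v." (for `σ = ℕ`-indexed variables this hypothesis is the positivity clause of
`Literature.Computability.MetaComplexity.IsPseudoexpectation 4`).
[cite: BarakBrandaoHarrowKelnerSteurerZhou2012, Thm. 2.2 (p. 3) and §3.2 (p. 9)] -/
theorem pseudoexpectation_fourthMoment_le (n d : ℕ)
    (E : MvPolynomial (Finset (Fin n)) ℝ →ₗ[ℝ] ℝ)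
    (hE : ∀ q : MvPolynomial (Finset (Fin n)) ℝ, q.totalDegree ≤ 2 → 0 ≤ E (q ^ 2)) :
    E (C ((2 : ℝ) ^ n)⁻¹ * ∑ x, fourierPoly (proj d fun S => X S) x ^ 4) ≤
      (9 : ℝ) ^ d * E ((∑ S : Finset (Fin n), X S ^ 2) ^ 2) := by
  have h := (sos_hypercontractivity_projector n d).pseudoexpectation_nonneg E hE
  rw [map_sub, ← smul_eq_C_mul, map_smul, smul_eq_mul] at h
  linarith

/-! ### §5 Multiplicativity of certificates and evaluation at real coefficients -/

namespace IsSosDeg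

/-- A square of degree `≤ j` times a certificate of degree `k` is a certificate of degree `j + k`.
[cite: KauersODonnellTanZhou2012, §2 (p. 6–7)] -/
theorem sq_mul {j k : ℕ} {a q : MvPolynomial σ ℝ} (ha : a.totalDegree ≤ j) (hq : IsSosDeg k q) :
    IsSosDeg (j + k) (a ^ 2 * q) := by
  obtain ⟨l, hl, rfl⟩ := hq
  induction l with
  | nil => simpa using IsSosDeg.zero (σ := σ) (j + k)
  | cons b l ih =>
    rw [List.map_cons, List.sum_cons, mul_add]
    refine IsSosDeg.add ?_ (ih fun b' hb' => hl b' (List.mem_cons_of_mem b hb'))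
    rw [← mul_pow]
    exact IsSosDeg.sq ((totalDegree_mul _ _).trans (add_le_add ha (hl b (by simp))))

/-- **Products of certificates**: `(Σ qᵢ²)(Σ rⱼ²) = Σ (qᵢ rⱼ)²`, degrees add ("each inequality is multiplied
against an SOS polynomial", KOTZ p. 9). [cite: KauersODonnellTanZhou2012, §2 (p. 6–7) and proof of Thm. 3.4 (p. 9)] -/
theorem mul {j k : ℕ} {p q : MvPolynomial σ ℝ} (hp : IsSosDeg j p) (hq : IsSosDeg k q) :
    IsSosDeg (j + k) (p * q) := by
  obtain ⟨l, hl, rfl⟩ := hp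
  induction l with
  | nil => simpa using IsSosDeg.zero (σ := σ) (j + k)
  | cons a l ih =>
    rw [List.map_cons, List.sum_cons, add_mul]
    exact (sq_mul (hl a (by simp)) hq).add (ih fun a' ha' => hl a' (List.mem_cons_of_mem a ha'))

end IsSosDeg

/-- **Evaluation bridge.** Substituting real numbers `c_S` for the coefficient indeterminates `X_S` turns the
universal Fourier polynomial into the real number `Σ_S c_S χ_S(x)`; with `c = ĝ` (the tree's
`cubeFourierCoeff g`) this is `g(x)` by Fourier inversion (`sum_cubeFourierCoeff_mul_walsh`).
[cite: BarakBrandaoHarrowKelnerSteurerZhou2012, §3.2 (p. 9: "for every fixed `w`, `f(w)` is a linear polynomial over these variables")] -/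
theorem eval_fourierPoly_X (c : Finset (Fin n) → ℝ) (x : Fin n → Bool) :
    MvPolynomial.eval c (fourierPoly (fun S => (X S : MvPolynomial (Finset (Fin n)) ℝ)) x) =
      ∑ S, c S * walsh S x := by
  unfold fourierPoly
  rw [map_sum]
  exact sum_congr rfl fun S _ => by rw [map_mul, eval_C, eval_X, mul_comm]

/-- The same at the Fourier coefficients of a real function `g` on the cube: the universal Fourier polynomial
evaluates to `g(x)`. [cite: BarakBrandaoHarrowKelnerSteurerZhou2012, §3.2 (p. 9)] -/
theorem eval_fourierPoly_X_cubeFourierCoeff (g : (Fin n → Bool) → ℝ) (x : Fin n → Bool) :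
    MvPolynomial.eval (Literature.Computability.Complexity.LowDegree.cubeFourierCoeff g)
      (fourierPoly (fun S => (X S : MvPolynomial (Finset (Fin n)) ℝ)) x) = g x := by
  rw [eval_fourierPoly_X]
  exact Literature.Computability.Complexity.LowDegree.sum_cubeFourierCoeff_mul_walsh g x

/-- Evaluating the projected Fourier polynomial: `(P_d f)(x) = Σ_{|S| ≤ d} c_S χ_S(x)`.
[cite: BarakBrandaoHarrowKelnerSteurerZhou2012, Thm. 2.2 (p. 3)] -/
theorem eval_fourierPoly_proj_X (d : ℕ) (c : Finset (Fin n) → ℝ) (x : Fin n → Bool) :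
    MvPolynomial.eval c (fourierPoly (proj d fun S => (X S : MvPolynomial (Finset (Fin n)) ℝ)) x) =
      ∑ S, (if S.card ≤ d then c S else 0) * walsh S x := by
  unfold fourierPoly proj
  rw [map_sum]
  refine sum_congr rfl fun S _ => ?_
  split_ifs <;> simp [eval_C, mul_comm]

/-- **BBHKSZ eq. (3.2), the numerical hypercontractive inequality, read off the certificate**: for real
coefficients `c_S` supported on `|S| ≤ d`, `2⁻ⁿ Σ_x (Σ_S c_S χ_S(x))⁴ ≤ 9^d (Σ_S c_S²)²` — Lemma 5.1
evaluated at a real point (`IsSosDeg.eval_nonneg`). (The tree's `LowDegree.bonami_even_moment`, `r = 2`, is the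
same inequality for a function `g` with `ĝ(S) = 0`, `|S| > d`, proved directly; this is its derivation from the
SOS certificate.) [cite: BarakBrandaoHarrowKelnerSteurerZhou2012, eq. (3.2) (p. 9)] -/
theorem hypercontractivity_of_certificate (d : ℕ) (c : Finset (Fin n) → ℝ) (hc : ∀ S, d < S.card → c S = 0) :
    ((2 : ℝ) ^ n)⁻¹ * ∑ x : Fin n → Bool, (∑ S, c S * walsh S x) ^ 4 ≤ (9 : ℝ) ^ d * (∑ S, c S ^ 2) ^ 2 := by
  classical
  have hX : ∀ S : Finset (Fin n), (proj d (fun S => (X S : MvPolynomial (Finset (Fin n)) ℝ)) S).totalDegree ≤ 1 := by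
    intro S; unfold proj; split_ifs
    · exact (totalDegree_X _).le
    · simp
  have had : ∀ S, d < S.card → proj d (fun S => (X S : MvPolynomial (Finset (Fin n)) ℝ)) S = 0 :=
    fun S hS => if_neg (not_le.2 hS)
  have h := (sos_hypercontractivity _ hX had).eval_nonneg c
  have e1 : MvPolynomial.eval c (sqNorm (proj d fun S => (X S : MvPolynomial (Finset (Fin n)) ℝ))) =
      ∑ S, c S ^ 2 := by
    unfold sqNorm proj
    rw [map_sum]
    refine sum_congr rfl fun S _ => ?_
    by_cases hS : S.card ≤ d
    · rw [if_pos hS, map_pow, eval_X]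
    · rw [if_neg hS, hc S (not_le.1 hS)]; simp
  have e2 : ∀ x : Fin n → Bool, MvPolynomial.eval c
      (fourierPoly (proj d fun S => (X S : MvPolynomial (Finset (Fin n)) ℝ)) x) = ∑ S, c S * walsh S x := by
    intro x
    rw [eval_fourierPoly_proj_X]
    refine sum_congr rfl fun S _ => ?_
    by_cases hS : S.card ≤ d
    · rw [if_pos hS]
    · rw [if_neg hS, hc S (not_le.1 hS)]
  rw [map_sub, map_mul, eval_C, map_pow, e1, map_mul, eval_C, map_sum] at h
  simp_rw [map_pow, e2] at h
  linarith

end Literature.Computability.Complexity.SosHypercontractivity
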